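import Literature.Barriers.CriticalPhenomena.SupercriticalSAWSpaceFillingRefutation
import Literature.Barriers.CriticalPhenomena.SupercriticalSAWSpaceFillingTilesTheorem6
import Literature.Barriers.CriticalPhenomena.SupercriticalSAWSpaceFillingTuned
import HarnessLib

/-!
# Barrier mechanism, twelfth audit: the SCALE axis — supercritical space-filling holds
# uniformly down to mesoscopic balls of radius `r(δ) ≫ δ log(1/δ)`, so fugacity-robust
# conclusions about the TRACE are obstructed at every intermediate scale, not only macroscopically

Barrier catalogue `Literature/Barriers/CriticalPhenomena/` (D-0021); twelfth audit (2026-08-16,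
refuter, "barrier-audit" gen 12) of the mechanism file `…Proofs` of `SupercriticalSAWSpaceFilling`
(= Theorem 1 of H. Duminil-Copin, G. Kozma, A. Yadin, *Supercritical self-avoiding walks are
space-filling*, Ann. IHP Probab. Stat. 50 (2014) 315–326, arXiv:1110.3074 — PROVED in the tree,
`SupercriticalSAWSpaceFilling_holds`; `blocks:` line `¬ RobustSAWScalingLimit` proved with no
hypothesis, `SupercriticalSAW.not_robustSAWScalingLimit`; axiom closures of both and of
`SupercriticalSAW.sawScalingLimitAt_iff_of_pos` re-checked in this audit: `propext`,
`Classical.choice`, `Quot.sound`).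

Generations 1–11 treated the FUGACITY axis (both sides of `x_c`, windows `x(δ) → x_c`, tuned and
annealed fugacities), the CONCLUSION axis (trace versus prefix / driving function; onto-compatible
conclusions; reversibility; the `(x, κ)` phase constraint), the LENGTH and DENSITY axes, and the
ENSEMBLE axis (canonical / kinetic ensembles carry no fugacity). Every one of those statements is
MACROSCOPIC: the weak space-filling property `SupercriticalSAW.IsSpaceFillingFamily` of §1 of the
source speaks of a FIXED open set `U ⊆ Ω`. This audit asks what Theorem 1 says at INTERMEDIATE
scales `δ ≪ r(δ) ≪ 1`, where several natural fugacity-robust statements live that are neither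
macroscopic trace statements nor prefix statements: "the trace of `γ_δ` around an interior point,
blown up by `1/r(δ)`, converges to whole-plane SLE_{8/3}" (the bi-infinite SAW picture), "the
trace near the starting point `a_δ`, blown up, converges to half-plane SLE_{8/3}", polynomial
decay of mesoscopic one-arm (proximity) probabilities, positive mesoscopic avoidance
probabilities.

Outcome of this audit: **CONFIRMED at page level and STRENGTHENED on the scale axis — Theorem 1
is a statement about holes of `c log(1/δ)` SITES, hence (proved here,
`SupercriticalSAW.tendsto_lawAt_avoidsSomeBall`) for every `x > x_c` the probability that the
supercritical walk of the unit disc avoids SOME ball `B(z, r(δ)) ⊆ 𝔻` tends to `0` as soon as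
`δ log(1/δ) / r(δ) → 0`, uniformly in the centre; equivalently, with probability `→ 1` every point
of `𝔻` at distance `≥ r(δ)` from `∂𝔻` is within `r(δ)` of the walk. Consequently fugacity-robust
conclusions about the trace are obstructed in every window of `L(δ) ≫ log(1/δ)` lattice spacings
(`SupercriticalSAW.tendsto_lawAt_avoidsSomeBall_latticeScale`), and the catalogue's evasion (iv)
("local limits at the starting point are not obstructed … however robust in `x`") is to be read
for PREFIX / first-exit statements and for MICROSCOPIC windows only.** One literature item is
added to `evasions_known` (the random-planar-map theorem of Gwynne–Miller, an instance of the
fugacity-free classes (v)/(vi)), and five further candidate classes are examined and reduced to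
catalogued ones (list in the barrier block below).

## What the audit found

1. **Mesoscopic space-filling (new theorem, from Theorem 1 as vendored).** The lattice-geometric
   lemma of `…Refutation` (`SupercriticalSAW.hasLargeHole_of_forall_notMem_ball`) is already
   quantitative: a walk of `𝔻_δ` visiting no mesh point of a ball `B(z, r) ⊆ 𝔻` with `8δ ≤ r`,
   `δξ ≤ r/2` leaves the `⌊r/(4δ)⌋ + 1` sites of a horizontal digital segment through `[z/δ]` in
   one component of the hole graph `𝔻_δ ∖ Γ_δ^ξ`. Theorem 1 bounds the largest hole component by
   `c(x) log(1/δ)` sites with probability `→ 1` (p. 2: "there exists a component of `𝔻_δ ∖ Γ_δ^ξ`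
   with cardinality `> c log(1/δ)`" has probability `→ 0`). So if `r = r(δ)` satisfies
   `δ log(1/δ)/r(δ) → 0`, then for small `δ` the event "SOME ball of radius `r(δ)` inside `𝔻`
   is avoided" (`SupercriticalSAW.AvoidsSomeBall`) is contained in the large-hole event, whatever
   the centre, and its probability tends to `0` (`tendsto_lawAt_avoidsSomeBall_of_DKY2014_thm1`;
   unconditionally `tendsto_lawAt_avoidsSomeBall`, Theorem 1 being `DKY2014_thm1_holds`). In
   lattice units (`tendsto_lawAt_avoidsSomeBall_latticeScale`): balls of `L(δ)` lattice spacings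
   with `log(1/δ)/L(δ) → 0`. The macroscopic weak space-filling of §1 is the constant-radius case
   (`isSpaceFillingFamily_of_tendsto_lawAt_avoidsSomeBall`). With the two-dimensional count of
   the sites of `B(z, r - ξδ)` instead of a segment the threshold would be `r(δ) ≫ δ √(log(1/δ))`;
   the tree keeps the segment, which suffices for every polynomially or polylogarithmically
   mesoscopic scale.
2. **Consequences for the technique class (the SCALE axis).** Every fugacity-robust conclusion
   about the TRACE of `γ_δ` in windows of size `r(δ)` with `δ log(1/δ) ≪ r(δ)` that fails for
   traces `o(r(δ))`-dense in the window — convergence of the blown-up trace around interior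
   points to whole-plane SLE_{8/3} or to any random closed set missing a ball with positive
   probability (Hausdorff / Fell topology: missing a closed ball is an open condition, so by the
   portmanteau inequality every limit of the blown-up traces a.s. contains the window),
   convergence of the blown-up trace near `a_δ` to half-plane SLE_{8/3}, positive mesoscopic
   avoidance probabilities, polynomial decay `r^{2-d_f}` of the one-arm probabilities
   `P[dist(z, γ_δ) ≤ r(δ)]` (they tend to `1`) — fails at every `x > x_c` exactly as its
   macroscopic counterpart does. There is no intermediate-scale refuge between the lattice scale
   and the domain scale: the obstruction is uniform down to `C(x) log(1/δ)` lattice spacings.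
   NOT obstructed by Theorem 1 at any scale, as for the macroscopic entry (xiii): statements about
   the TIME ORDER of visits and multi-arm / crossing-number / strand-separation events (a dense
   trace can cross an annulus twice), on which the source has "very little additional
   information" (p. 8).
3. **Evasion (iv) sharpened, not withdrawn.** `…ProofsNarrow` (gen 2) records that Theorem 1
   constrains only the law of the final trace, so that prefix-level statements (the curve stopped
   at the first visit of a closed set, driving functions on compact capacity intervals, "local
   limits at the starting point") are not obstructed "however robust in `x` they are". That is
   correct for PREFIX / FIRST-EXIT formulations (the law of `γ_δ` up to its first exit from
   `B(a, ρ(δ))`, any `ρ(δ)`) — the filling surgery of gen 2 shows Theorem 1's conclusion is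
   compatible with any prefix laws — and for MICROSCOPIC trace statements (windows of
   `O(log(1/δ))` lattice spacings: pattern frequencies, Kesten-type local configurations). It is
   NOT correct for the TRACE restricted to a mesoscopic neighbourhood of `a_δ` (or of any point):
   the trace of the supercritical walk is `r(δ)`-dense in `B(a, ρ(δ)) ∩ {dist(·, ∂𝔻) ≥ r(δ)}`
   with probability `→ 1` whenever `δ log(1/δ) ≪ r(δ) < ρ(δ)/2` (item 1 with centres near `a`). Routes that "first prove the half-plane picture locally near `a_δ`,
   then bootstrap" must therefore phrase the local step through first-exit laws, or pin `x_c`.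
4. **Literature: the one theorem identifying a self-avoiding walk with SLE_{8/3} carries no
   fugacity.** E. Gwynne, J. Miller, Ann. Sci. ÉNS 54 (2021), arXiv:1608.00956, Theorems 1.1–1.3
   (arXiv pp. 6–7): the uniform infinite SAW-decorated half-planar / whole-planar quadrangulations
   converge (local GHPU topology) to `√(8/3)`-LQG wedges / cones decorated by an independent
   chordal / two-sided / whole-plane SLE_{8/3}. The discrete objects are CANONICAL: "the uniform
   measure on pairs `(Q, λ)` … glue [two uniform quadrangulations of the disk with `n`
   quadrilaterals and boundary length `2l`] along a boundary segment of length `2s` … the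
   conditional law of the interface … [is] that of a SAW of length `2s`" and the infinite-volume
   versions are gluings of independent UIHPQ_S's (arXiv p. 4). No fugacity is tuned, the lattice is
   random and annealed: an instance of the catalogue's classes (v) (canonical ensembles) and (vi)
   (another point of the critical manifold of models). Theorem 1 is silent about it; what separates
   it from `δℤ²` is an embedding / universality transfer that no entry of this catalogue concerns.
   Recorded in `evasions_known` because the catalogue did not mention it.
5. **Five further candidate classes, examined and reduced** (no declaration; one line each in the
   block): complex-fugacity slit neighbourhoods (the complexification of the LEFT class (xii);
   ACROSS `x_c` no `δ`-uniform zero-free complex neighbourhood of the partition function can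
   exist once the finite-volume free energy has a limit vanishing up to the critical fugacity and
   positive beyond — `δ² log Z_δ` is then uniformly bounded above on the neighbourhood, a normal
   family of holomorphic logarithms would make the limit real-analytic through `x_c` (Montel,
   identity theorem), the Yang–Lee mechanism; for walks crossing an `n × n` square this is
   unconditional: `𝓗(z) = lim n⁻² log ς_n(z)` exists for all `z`, vanishes where the linear free
   energy is finite, i.e. for `z ≤ 1/μ`, and is positive for `z > 1/μ` (Janse van Rensburg,
   Thm 5.74, p. 215 and Thm 5.77 with Cor. 5.78, p. 219 of the held text; Madras 1995), so the
   zeros of `ς_n` accumulate at `1/μ`; for the disc ensemble positivity beyond `x_c` is the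
   source's "length of order `1/δ²`" remark, p. 8); conditioning on the length (the conditional law of `P_{(Ω_δ,a_δ,b_δ,x)}` given
   `|γ_δ| = n` is the uniform law on `n`-step walks, independent of `x`: the fugacity acts through
   the one-dimensional length marginal only — class (v)); inhomogeneous fugacity fields (a
   perturbation supercritical on an open subregion is obstructed in substance by the LOCAL polygon
   insertion of Proposition 7, p. 6, by no declaration; perturbations carried by the boundary or a
   curve are surface / pinning transitions of type (vi)); conditional conclusions "if the limit is
   not onto then it is SLE_{8/3}" (vacuously right-robust — the conjunct splitting of (xii));
   unbounded domains (outside the sub-problem: `DobrushinDomain` is a bounded Jordan domain; in a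
   half-plane or strip the supercritical weights have infinite mass for small `δ` and `lawAt x` is
   the junk zero measure).
6. **Confirmed (page level, arXiv text of the source re-read in this audit).** p. 2: the three
   phases, the weak sense of space-filling, Theorem 1 verbatim ("there exist `ξ = ξ(x) > 0` and
   `c = c(x) > 0` such that `P[∃ a component of 𝔻_δ ∖ Γ_δ^ξ with cardinality > c log(1/δ)] → 0`");
   p. 3: Theorem 2, "the reasoning carries over to all dimensions", other lattices; pp. 4–5:
   Proposition 3, bridges `e^{-c√n} μⁿ ≤ b_n ≤ μⁿ`, Lemma 5, "finding the maximal `m` … seems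
   difficult, probably no easier than the SLE_{8/3} conjecture. But we do not need to know its
   value"; pp. 5–7: Theorem 6, Proposition 7 (`P(bdist(γ_δ, V_F) = 1) ≤ C(x,m) Z_m(x)^{-|F|}`),
   the Peierls sum `(C/δ²) 2^{-s/(2m+1)²}`; p. 8: "It is not difficult to show that the length is
   of order `1/δ²`", Problems 9–10, Conjecture 11 (hexagonal lattice; SLE_{8/3} at `x = 1/μ`, SLE₈
   above). Forward literature 2023–2026 (arXiv and Crossref APIs; the hub's local full-text index
   and the OpenAlex / Semantic Scholar cascades were unavailable or rate-limited during this audit,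
   recorded as such): quantitative sub-ballisticity at `x_c` on the hexagonal lattice via the
   parafermionic observable (Krachun–Panagiotis, Ann. Probab. 54 (2026)) — a critical-phase
   result using the exact `x_c`, consistent with the catalogue's reading of Problem 10's family;
   massive two-point bounds above four dimensions (Liu, EJP 30 (2025)); lattice-polymer numerics
   on compressed / dense phases (Phys. Rev. E 112 (2025) 054126); nothing on supercritical planar
   scaling limits, on Problem 10, or contradicting Theorem 1.

## Formal content (all proved; one new closed `Prop`, `SupercriticalSAWSpaceFillingMesoscopic`)

`SupercriticalSAW.AvoidsSomeBall`, `SupercriticalSAW.tendsto_lawAt_avoidsSomeBall_of_DKY2014_thm1`,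
`SupercriticalSAW.tendsto_lawAt_avoidsSomeBall`, `SupercriticalSAW.tendsto_lawAt_forall_notMem_ball`
(a given family of balls), `SupercriticalSAW.tendsto_lawAt_avoidsSomeBall_latticeScale`,
`SupercriticalSAW.isSpaceFillingFamily_of_tendsto_lawAt_avoidsSomeBall` (the macroscopic notion
is the constant-radius case); the closed `Prop` `SupercriticalSAWSpaceFillingMesoscopic` and
`SupercriticalSAWSpaceFillingMesoscopic_holds`.

Mathlib: `Real.log_lt_iff_lt_exp`, `Real.log_inv`, `Nat.lt_floor_add_one`, `Ioo_mem_nhdsGT`,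
`Iio_mem_nhds`, `Filter.Tendsto.eventually`, `tendsto_of_tendsto_of_tendsto_of_le_of_le'`; from
`…Tuned`: `SupercriticalSAW.tendsto_mul_log_one_div_nhdsGT` (`δ log(1/δ) → 0`).

## References (page-level, audit 2026-08-16; pages of the arXiv versions)

* H. Duminil-Copin, G. Kozma, A. Yadin, Ann. IHP Probab. Stat. 50 (2014) 315–326,
  arXiv:1110.3074: p. 2 (§1; Theorem 1), p. 3 (Theorem 2; all dimensions; other lattices),
  pp. 4–5 (Proposition 3, Lemma 5), pp. 5–7 (Theorem 6, Proposition 7, the Peierls sum),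
  p. 8 (§4: Problems 9–10, Conjecture 11). [DuminilCopinKozmaYadin2014]
* E. Gwynne, J. Miller, *Convergence of the self-avoiding walk on random quadrangulations to
  SLE_{8/3} on √(8/3)-Liouville quantum gravity*, Ann. Sci. ÉNS 54 (2021), arXiv:1608.00956:
  p. 4 (uniform SAW-decorated quadrangulations; gluing of UIHPQ_S), pp. 6–7 (Theorems 1.1–1.3).
  [GwynneMiller2021SAW]
* D. Krachun, C. Panagiotis, *Quantitative sub-ballisticity of self-avoiding walk on the
  hexagonal lattice*, Ann. Probab. 54 (2026). [KrachunPanagiotis2026]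
* E. J. Janse van Rensburg, *The statistical mechanics of interacting walks, polygons, animals
  and vesicles*, 2nd ed., OUP (2015): §5.6.1, Thm 5.74 (p. 215 of the held text: the limits
  `𝓕_ς(z) = lim n⁻¹ log ς_n(z)`, `𝓗_ς(z) = lim n⁻² log ς_n(z)` exist for `z ∈ [0, ∞]`, and
  `𝓗_ς(z) = 0` if `𝓕_ς(z)` is finite), Thm 5.77 and Cor. 5.78 (p. 219: `𝓗_ς(z) > 0` for
  `z > 1/μ₂`, "Thus, `z_c = μ₂⁻¹`"; "`𝓕_ς(z_c) = 0`"). [Jansevanrensburg2015]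
* N. Madras, *Critical behaviour of self-avoiding walks that cross a square*, J. Phys. A 28
  (1995) 1535–1547 (the square-crossing free energy). [Madras1995]
* P. Billingsley, *Convergence of probability measures*, 2nd ed. (1999), Thm 2.1. [Billingsley1999]
-/

noncomputable section

open MeasureTheory Filter Topology Metric Set Literature.Probability.LatticeModels
  Literature.Probability.Percolation Literature.Probability.RandomPlanarGeometry
  Literature.Probability.RandomPlanarGeometry.SAW
open scoped ENNReal NNReal

namespace Literature.Barriers.CriticalPhenomena

namespace SupercriticalSAW

variable {δ : ℝ} {a b : Site 2}

/-! ### The mesoscopic avoidance event -/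

/-- **Mesoscopic avoidance**: the walk `γ` of `𝔻_δ` visits no mesh point of SOME ball
`B(z, r) ⊆ 𝔻` of radius `r` (centre arbitrary). Its complement says that every point of `𝔻` at
distance `≥ r` from `∂𝔻` lies within `r` of a visited mesh point — the trace is `r`-dense in
`{z : dist(z, ∂𝔻) ≥ r}`. For a fixed open `U ⊇ B(z, r)` this is the event of the weak
space-filling property of §1 ("for any open set `U ⊂ Ω`, `P[γ_δ ∩ U = ∅] → 0`").
[cite: DuminilCopinKozmaYadin2014, §1 (When x > 1/μ) and Theorem 1] -/
def AvoidsSomeBall (r : ℝ) (γ : DomainSAW unitDisk δ a b) : Prop :=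
  ∃ z : ℂ, ball z r ⊆ unitDisk ∧ ∀ v ∈ γ.walk.support, meshPoint δ v ∉ ball z r

/-- A walk avoiding a given ball inside `𝔻` avoids some ball. [folklore] -/
theorem avoidsSomeBall_of_forall_notMem_ball {r : ℝ} {z : ℂ} (hz : ball z r ⊆ unitDisk)
    {γ : DomainSAW unitDisk δ a b} (hγ : ∀ v ∈ γ.walk.support, meshPoint δ v ∉ ball z r) :
    AvoidsSomeBall r γ :=
  ⟨z, hz, hγ⟩

/-! ### Theorem 1 at mesoscopic scales -/

/-- **Mesoscopic space-filling from Theorem 1 of Duminil-Copin–Kozma–Yadin.** In the unit disk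
with boundary points `a ≠ b`, closest-site endpoints `a_δ = A δ`, `b_δ = B δ` and a supercritical
fugacity `x > x_c`: for EVERY family of radii `r(δ) > 0` with `δ log(1/δ) / r(δ) → 0` (e.g.
`r(δ) = δ^θ`, `θ < 1`, or `r(δ) = δ log²(1/δ)`),
`P_{(𝔻_δ,a_δ,b_δ,x)}[γ_δ avoids some ball B(z, r(δ)) ⊆ 𝔻] → 0` as `δ → 0⁺`, uniformly in the
centre (the event quantifies over all centres). Proof: Theorem 1 (`DKY2014_thm1`) gives `ξ, c > 0`
with `P[some component of 𝔻_δ ∖ Γ_δ^ξ has > c log(1/δ) sites] → 0`; for `δ < e⁻¹` and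
`δ log(1/δ) < ε r(δ)`, `ε = min(1/8, 1/(2ξ), 1/(4c))`, one has `8δ ≤ r(δ)`, `δξ ≤ r(δ)/2` and
`c log(1/δ) < ⌊r(δ)/(4δ)⌋ + 1`, so an avoided ball `B(z, r(δ)) ⊆ 𝔻` produces such a component
(`hasLargeHole_of_forall_notMem_ball`: a digital segment of `⌊r/(4δ)⌋ + 1` hole sites through
`[z/δ]`), and monotonicity of the measure concludes. The printed Theorem 1 (p. 2) is exactly this
strong: it bounds holes by `c log(1/δ)` SITES, i.e. by `O(log(1/δ))` lattice spacings in
diameter along any lattice line. [cite: DuminilCopinKozmaYadin2014, Theorem 1] -/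
theorem tendsto_lawAt_avoidsSomeBall_of_DKY2014_thm1 (h : DKY2014_thm1) {a b : ℂ}
    (ha : ‖a‖ = 1) (hb : ‖b‖ = 1) (hab : a ≠ b) {A B : ℝ → Site 2}
    (hAB : ∀ δ : ℝ, 0 < δ → IsClosestSite unitDisk δ a (A δ) ∧ IsClosestSite unitDisk δ b (B δ))
    {x : ℝ} (hx : criticalFugacity < x) {r : ℝ → ℝ} (hr0 : ∀ δ : ℝ, 0 < δ → 0 < r δ)
    (hr : Tendsto (fun δ : ℝ => δ * Real.log (1 / δ) / r δ) (𝓝[>] 0) (𝓝 0)) :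
    Tendsto (fun δ : ℝ => lawAt x unitDisk δ (A δ) (B δ) {γ | AvoidsSomeBall (r δ) γ})
      (𝓝[>] 0) (𝓝 0) := by
  obtain ⟨ξ, hξ, c, hc, hT⟩ := h a b ha hb hab x hx
  have hT := hT A B hAB
  -- the threshold ratio `ε`: below it the three side conditions of the lattice lemma hold
  set ε : ℝ := min (min (1 / 8) (1 / (2 * ξ))) (1 / (4 * c)) with hε
  have hεpos : 0 < ε := lt_min (lt_min (by norm_num) (by positivity)) (by positivity)
  have hε8 : ε ≤ 1 / 8 := (min_le_left _ _).trans (min_le_left _ _)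
  have hεξ : ε ≤ 1 / (2 * ξ) := (min_le_left _ _).trans (min_le_right _ _)
  have hεc : ε ≤ 1 / (4 * c) := min_le_right _ _
  have hsmall : ∀ᶠ δ in 𝓝[>] (0 : ℝ), δ ∈ Ioo 0 (Real.exp (-1)) := Ioo_mem_nhdsGT (Real.exp_pos _)
  have hrat : ∀ᶠ δ in 𝓝[>] (0 : ℝ), δ * Real.log (1 / δ) / r δ < ε :=
    hr.eventually (Iio_mem_nhds hεpos)
  have hev : ∀ᶠ δ in 𝓝[>] (0 : ℝ),
      lawAt x unitDisk δ (A δ) (B δ) {γ | AvoidsSomeBall (r δ) γ} ≤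
        lawAt x unitDisk δ (A δ) (B δ) {γ | HasLargeHole ξ (c * Real.log (1 / δ)) γ} := by
    filter_upwards [hsmall, hrat] with δ hδ ht
    have hδ0 : 0 < δ := hδ.1
    have hrpos : 0 < r δ := hr0 δ hδ0
    -- `δ < e⁻¹` gives `log(1/δ) ≥ 1`, so `δ ≤ δ log(1/δ) < ε r(δ)`
    have hlog1 : 1 ≤ Real.log (1 / δ) := by
      rw [one_div, Real.log_inv]
      have := (Real.log_lt_iff_lt_exp hδ0).2 hδ.2
      linarith
    have h1 : δ * Real.log (1 / δ) < ε * r δ := by rwa [div_lt_iff₀ hrpos] at ht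
    have hδle : δ ≤ δ * Real.log (1 / δ) := le_mul_of_one_le_right hδ0.le hlog1
    have hδ8 : 8 * δ ≤ r δ := by
      have h8 : ε * r δ ≤ 1 / 8 * r δ := mul_le_mul_of_nonneg_right hε8 hrpos.le
      linarith
    have hδξ : δ * ξ ≤ r δ / 2 := by
      have hξε : ε * (2 * ξ) ≤ 1 := by rwa [le_div_iff₀ (by positivity)] at hεξ
      have h2 : δ * Real.log (1 / δ) * (2 * ξ) ≤ ε * r δ * (2 * ξ) :=
        mul_le_mul_of_nonneg_right h1.le (by positivity)
      have h3 : ε * r δ * (2 * ξ) = r δ * (ε * (2 * ξ)) := by ring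
      have h4 : r δ * (ε * (2 * ξ)) ≤ r δ * 1 := mul_le_mul_of_nonneg_left hξε hrpos.le
      have h5 : δ * ξ ≤ δ * Real.log (1 / δ) * ξ := by
        have := mul_le_mul_of_nonneg_right hδle hξ.le
        linarith
      nlinarith
    have hs : c * Real.log (1 / δ) < (⌊r δ / (4 * δ)⌋₊ : ℝ) + 1 := by
      refine lt_of_lt_of_le ?_ (Nat.lt_floor_add_one _).le
      rw [lt_div_iff₀ (by positivity)]
      have hcε : ε * (4 * c) ≤ 1 := by rwa [le_div_iff₀ (by positivity)] at hεc
      have h2 : c * Real.log (1 / δ) * (4 * δ) = 4 * c * (δ * Real.log (1 / δ)) := by ring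
      have h3 : 4 * c * (δ * Real.log (1 / δ)) < 4 * c * (ε * r δ) :=
        mul_lt_mul_of_pos_left h1 (by positivity)
      have h4 : 4 * c * (ε * r δ) = r δ * (ε * (4 * c)) := by ring
      have h5 : r δ * (ε * (4 * c)) ≤ r δ * 1 := mul_le_mul_of_nonneg_left hcε hrpos.le
      linarith
    -- an avoided ball of radius `r(δ)` is a hole of more than `c log(1/δ)` sites
    refine measure_mono fun γ hγ => ?_
    obtain ⟨z, hball, hγ⟩ := hγ
    exact hasLargeHole_of_forall_notMem_ball hδ0 hball hδ8 hδξ (hAB δ hδ0).1.1 hs γ hγ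
  exact tendsto_of_tendsto_of_tendsto_of_le_of_le' tendsto_const_nhds hT
    (Eventually.of_forall fun δ => zero_le) hev

/-- **Mesoscopic space-filling of the supercritical self-avoiding walk, unconditionally**
(Theorem 1 is a theorem of the tree, `DKY2014_thm1_holds`): for `x > x_c`, closest-site
endpoints of `(𝔻; a, b)`, `a ≠ b` on `∂𝔻`, and radii with `δ log(1/δ)/r(δ) → 0`, the
probability that the walk avoids some ball `B(z, r(δ)) ⊆ 𝔻` tends to `0`.
[cite: DuminilCopinKozmaYadin2014, Theorem 1] -/
theorem tendsto_lawAt_avoidsSomeBall {a b : ℂ} (ha : ‖a‖ = 1) (hb : ‖b‖ = 1) (hab : a ≠ b)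
    {A B : ℝ → Site 2}
    (hAB : ∀ δ : ℝ, 0 < δ → IsClosestSite unitDisk δ a (A δ) ∧ IsClosestSite unitDisk δ b (B δ))
    {x : ℝ} (hx : criticalFugacity < x) {r : ℝ → ℝ} (hr0 : ∀ δ : ℝ, 0 < δ → 0 < r δ)
    (hr : Tendsto (fun δ : ℝ => δ * Real.log (1 / δ) / r δ) (𝓝[>] 0) (𝓝 0)) :
    Tendsto (fun δ : ℝ => lawAt x unitDisk δ (A δ) (B δ) {γ | AvoidsSomeBall (r δ) γ})
      (𝓝[>] 0) (𝓝 0) :=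
  tendsto_lawAt_avoidsSomeBall_of_DKY2014_thm1 DKY2014_thm1_holds ha hb hab hAB hx hr0 hr

/-- **A given mesoscopic family of balls is visited with probability `→ 1`**: for centres `z(δ)`
with `B(z(δ), r(δ)) ⊆ 𝔻` (e.g. balls shrinking onto an interior point, or sliding towards the
starting point `a` at distance `2 r(δ)` from it) and `δ log(1/δ)/r(δ) → 0`,
`P_{(𝔻_δ,a_δ,b_δ,x)}[γ_δ ∩ B(z(δ), r(δ)) = ∅] → 0` for every `x > x_c`.
[cite: DuminilCopinKozmaYadin2014, Theorem 1] -/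
theorem tendsto_lawAt_forall_notMem_ball {a b : ℂ} (ha : ‖a‖ = 1) (hb : ‖b‖ = 1) (hab : a ≠ b)
    {A B : ℝ → Site 2}
    (hAB : ∀ δ : ℝ, 0 < δ → IsClosestSite unitDisk δ a (A δ) ∧ IsClosestSite unitDisk δ b (B δ))
    {x : ℝ} (hx : criticalFugacity < x) {r : ℝ → ℝ} (hr0 : ∀ δ : ℝ, 0 < δ → 0 < r δ)
    (hr : Tendsto (fun δ : ℝ => δ * Real.log (1 / δ) / r δ) (𝓝[>] 0) (𝓝 0))
    {z : ℝ → ℂ} (hz : ∀ δ : ℝ, 0 < δ → ball (z δ) (r δ) ⊆ unitDisk) :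
    Tendsto (fun δ : ℝ => lawAt x unitDisk δ (A δ) (B δ)
        {γ | ∀ v ∈ γ.walk.support, meshPoint δ v ∉ ball (z δ) (r δ)}) (𝓝[>] 0) (𝓝 0) := by
  have hev : ∀ᶠ δ in 𝓝[>] (0 : ℝ),
      lawAt x unitDisk δ (A δ) (B δ) {γ | ∀ v ∈ γ.walk.support, meshPoint δ v ∉ ball (z δ) (r δ)}
        ≤ lawAt x unitDisk δ (A δ) (B δ) {γ | AvoidsSomeBall (r δ) γ} := by
    filter_upwards [self_mem_nhdsWithin] with δ hδ
    exact measure_mono fun γ hγ => avoidsSomeBall_of_forall_notMem_ball (hz δ hδ) hγ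
  exact tendsto_of_tendsto_of_tendsto_of_le_of_le' tendsto_const_nhds
    (tendsto_lawAt_avoidsSomeBall ha hb hab hAB hx hr0 hr) (Eventually.of_forall fun δ => zero_le)
    hev

/-- **The lattice-scale form**: balls of `L(δ)` lattice spacings, `r(δ) = δ L(δ)`, with
`log(1/δ)/L(δ) → 0` — every window of `≫ log(1/δ)` lattice spacings inside `𝔻` is visited with
probability `→ 1`, uniformly in its position, at every `x > x_c`. Below `O(log(1/δ))` spacings
Theorem 1 is silent (its holes have `≤ c(x) log(1/δ)` sites). [cite: DuminilCopinKozmaYadin2014, Theorem 1] -/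
theorem tendsto_lawAt_avoidsSomeBall_latticeScale {a b : ℂ} (ha : ‖a‖ = 1) (hb : ‖b‖ = 1)
    (hab : a ≠ b) {A B : ℝ → Site 2}
    (hAB : ∀ δ : ℝ, 0 < δ → IsClosestSite unitDisk δ a (A δ) ∧ IsClosestSite unitDisk δ b (B δ))
    {x : ℝ} (hx : criticalFugacity < x) {L : ℝ → ℝ} (hL0 : ∀ δ : ℝ, 0 < δ → 0 < L δ)
    (hL : Tendsto (fun δ : ℝ => Real.log (1 / δ) / L δ) (𝓝[>] 0) (𝓝 0)) :
    Tendsto (fun δ : ℝ => lawAt x unitDisk δ (A δ) (B δ) {γ | AvoidsSomeBall (δ * L δ) γ})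
      (𝓝[>] 0) (𝓝 0) := by
  refine tendsto_lawAt_avoidsSomeBall ha hb hab hAB hx (fun δ hδ => mul_pos hδ (hL0 δ hδ)) ?_
  refine hL.congr' ?_
  filter_upwards [self_mem_nhdsWithin] with δ hδ
  rw [mul_div_mul_left _ _ (ne_of_gt hδ)]

/-- **The macroscopic notion is the constant-radius case**: mesoscopic space-filling (for all
radii with `δ log(1/δ)/r(δ) → 0`) implies the weak space-filling property of §1
(`IsSpaceFillingFamily`), since a nonempty open `U ⊆ 𝔻` contains a ball and `δ log(1/δ) → 0`.
[cite: DuminilCopinKozmaYadin2014, §1 (When x > 1/μ)] -/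
theorem isSpaceFillingFamily_of_tendsto_lawAt_avoidsSomeBall {x : ℝ} {A B : ℝ → Site 2}
    (h : ∀ r : ℝ, 0 < r →
      Tendsto (fun δ : ℝ => lawAt x unitDisk δ (A δ) (B δ) {γ | AvoidsSomeBall r γ})
        (𝓝[>] 0) (𝓝 0)) :
    IsSpaceFillingFamily x unitDisk A B := by
  intro U hU hUΩ hUne
  obtain ⟨z, hz⟩ := hUne
  obtain ⟨r, hr, hzr⟩ := Metric.isOpen_iff.1 hU z hz
  refine tendsto_of_tendsto_of_tendsto_of_le_of_le' tendsto_const_nhds (h r hr)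
    (Eventually.of_forall fun δ => zero_le) (Eventually.of_forall fun δ => ?_)
  exact measure_mono fun γ hγ =>
    avoidsSomeBall_of_forall_notMem_ball (hzr.trans hUΩ) fun v hv hvz => hγ v hv (hzr hvz)

/-- In particular the constant-radius instances of `tendsto_lawAt_avoidsSomeBall` recover the
macroscopic weak space-filling of the supercritical walk of the disc
(`isSpaceFillingFamily_of_DKY2014_thm1` of `…Refutation`, re-derived through the scale axis).
[cite: DuminilCopinKozmaYadin2014, §1 (When x > 1/μ) and Theorem 1] -/
theorem isSpaceFillingFamily_of_lt_criticalFugacity' {a b : ℂ} (ha : ‖a‖ = 1) (hb : ‖b‖ = 1)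
    (hab : a ≠ b) {A B : ℝ → Site 2}
    (hAB : ∀ δ : ℝ, 0 < δ → IsClosestSite unitDisk δ a (A δ) ∧ IsClosestSite unitDisk δ b (B δ))
    {x : ℝ} (hx : criticalFugacity < x) : IsSpaceFillingFamily x unitDisk A B :=
  isSpaceFillingFamily_of_tendsto_lawAt_avoidsSomeBall fun r hr =>
    tendsto_lawAt_avoidsSomeBall ha hb hab hAB hx (fun _ _ => hr)
      (by simpa only [zero_div] using tendsto_mul_log_one_div_nhdsGT.div_const r)

end SupercriticalSAW

open SupercriticalSAW

/-! ### The audited barrier (twelfth audit): the scale axis -/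

/-- **Barrier `SupercriticalSAWSpaceFillingMesoscopic`** (twelfth audit of the mechanism of
`SupercriticalSAWSpaceFilling`; PROVED below, `SupercriticalSAWSpaceFillingMesoscopic_holds`):
Theorem 1 of Duminil-Copin–Kozma–Yadin in its MESOSCOPIC form — in the unit disk with boundary
points `a ≠ b`, closest-site endpoints and any fugacity `x > x_c = 1/μ`, for every family of radii
`r(δ) > 0` with `δ log(1/δ)/r(δ) → 0` the probability that the walk avoids some ball
`B(z, r(δ)) ⊆ 𝔻` tends to `0` as `δ → 0⁺` (uniformly in the centre): the supercritical walk is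
`r(δ)`-dense in `{dist(·, ∂𝔻) ≥ r(δ)}` with probability `→ 1` at every scale above
`C(x) δ log(1/δ)`.

BARRIER (structured block, D-0021):
- technique_class: that of `SupercriticalSAWSpaceFilling` (fugacity-robust, `δ`-uniform conclusions about the fugacity-`x` self-avoiding walk), extended along the SCALE axis: any `x`-robust conclusion about the TRACE of `γ_δ` in windows of size `r(δ)` with `δ log(1/δ) ≪ r(δ) ≤ 1` that fails for traces `o(r(δ))`-dense in the window — convergence of the blown-up trace around interior points to whole-plane SLE_{8/3} (or to any random closed set missing a ball with positive probability), of the blown-up trace near `a_δ` to half-plane SLE_{8/3}, positive mesoscopic avoidance probabilities, polynomial decay of one-arm (proximity) probabilities `P[dist(z, γ_δ) ≤ r(δ)]`; NOT in the class (undetermined by Theorem 1 at any scale): time order of visits, multi-arm / crossing-number / strand-separation events, cf. (xiii) of the base entry [cite: DuminilCopinKozmaYadin2014, Theorem 1] [cite: DuminilCopinKozmaYadin2014, §4 (before Problem 9)]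
- blocks: at every single `x > x_c`, each conclusion of that class (the event `SupercriticalSAW.AvoidsSomeBall (r δ)` has probability `→ 0`, `SupercriticalSAW.tendsto_lawAt_avoidsSomeBall`, `SupercriticalSAW.tendsto_lawAt_forall_notMem_ball`, `SupercriticalSAW.tendsto_lawAt_avoidsSomeBall_latticeScale`; the macroscopic class of the base entry is the constant-radius case, `SupercriticalSAW.isSpaceFillingFamily_of_tendsto_lawAt_avoidsSomeBall`), hence every right-closed or two-sided `x`-robust version of it, exactly as for the macroscopic trace conclusions of the base entry and of `…ProofsOnto` [cite: DuminilCopinKozmaYadin2014, Theorem 1]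
- because: Theorem 1 bounds the largest component of `𝔻_δ ∖ Γ_δ^ξ` by `c(x) log(1/δ)` SITES with probability `→ 1` [cite: DuminilCopinKozmaYadin2014, Theorem 1], and a ball `B(z, r) ⊆ 𝔻` free of visited mesh points with `8δ ≤ r`, `ξδ ≤ r/2` contains a digital segment of `⌊r/(4δ)⌋ + 1 > c log(1/δ)` hole sites in one component (`SupercriticalSAW.hasLargeHole_of_forall_notMem_ball`) as soon as `4c δ log(1/δ) < r`; the three side conditions hold for small `δ` whenever `δ log(1/δ)/r(δ) → 0`
- evasions_known: those of the base entry, with (iv) ("prefix / driving-function / local limits at the starting point are not obstructed, however robust in `x`") READ CORRECTLY: unobstructed are PREFIX / FIRST-EXIT formulations (the law of `γ_δ` stopped on leaving `B(a, ρ(δ))`, any `ρ(δ)`; driving functions on compact capacity intervals) and MICROSCOPIC trace statements (windows of `O(log(1/δ))` lattice spacings — formally; `O(√log(1/δ))` with the two-dimensional site count — such as pattern frequencies and lattice-scale local configurations), NOT the trace restricted to a mesoscopic neighbourhood of `a_δ` or of any other point, which the supercritical walk fills [cite: DuminilCopinKozmaYadin2014, Theorem 1]; windows coordinated with a near-critical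 fugacity `x(δ) → x_c` remain of type (i) (`…Narrow`); ADDED to the base list as literature, not as a gap in Theorem 1: (xv) the RANDOM-GEOMETRY instance of the fugacity-free classes (v)/(vi) — the only theorem identifying a self-avoiding walk with SLE_{8/3}, for uniform SAW-decorated random quadrangulations (canonical: fixed face number and walk length, or their infinite-volume local limits, gluings of independent UIHPQ_S's; annealed random lattice), converging to SLE_{8/3} on `√(8/3)`-Liouville quantum gravity [cite: GwynneMiller2021SAW, Theorems 1.1–1.3] — no fugacity is tuned there and Theorem 1 says nothing about it; its distance from `δℤ²` is an embedding / universality transfer outside this catalogue entry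
- scope_caveats: proved for the unit disk with closest-site endpoints (the setting of Theorem 1; general bounded domains only after microscopic expansion [cite: DuminilCopinKozmaYadin2014, Theorem 2]) and for balls INSIDE `𝔻` (windows at the boundary enter through balls `B(z, r(δ)) ⊆ 𝔻` tangent from inside); the formal threshold is `r(δ) ≫ δ log(1/δ)` (segment count), the natural one `δ √(log(1/δ))` (disc count) is not formalised, and NOTHING is asserted below `O(log(1/δ))` lattice spacings, where Theorem 1 is silent and the supercritical trace is predicted to be SLE₈-like only above the lattice scale [cite: DuminilCopinKozmaYadin2014, §4 (p. 8, Smirnov's SLE₈ prediction for x > 1/μ)]; the statement concerns the TRACE (the set of visited mesh points), not prefixes or the time order of visits ("We know that the curve becomes space-filling, yet we have very little additional information" [cite: DuminilCopinKozmaYadin2014, §4 (before Problem 9)]); examined in this audit and reduced to catalogued classes, by no declaration: complex-fugacity slit neighbourhoods of `x_c` (the complexification of the left class (xii); no `δ`-uniform zero-free complex neighbourhood of `x_c` for the partition function is compatible with a limiting free energy vanishing up to `x_c` and positive beyond — normal families and the identity theorem, the Yang–Lee mechanism — so analytic continuation ACROSS `x_c` is not a passage either; unconditional for walks crossing a square,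 whose free energy `lim n⁻² log ς_n(z)` exists, vanishes for `z ≤ 1/μ` and is positive beyond [cite: Jansevanrensburg2015, Thm 5.74 and Thm 5.77] [cite: Madras1995]; for the disc ensemble positivity is the source's remark "the length is of order `1/δ²`" [cite: DuminilCopinKozmaYadin2014, §4 (Problem 9)]), conditioning on the length (given `|γ_δ| = n` the law is uniform on `n`-step walks for every `x > 0`: the fugacity acts through the length marginal only, class (v)), fugacity fields supercritical on an open subregion (obstructed in substance by the local polygon insertion [cite: DuminilCopinKozmaYadin2014, Proposition 7], formalised for homogeneous `x` only) versus carried by the boundary or a curve (surface / pinning transitions, type (vi)), conditional conclusions "not onto ⇒ SLE_{8/3}" (vacuously right-robust; the conjunct splitting of (xii)), unbounded domains (not Dobrushin domains of the library, which are bounded Jordan domains; in a half-plane or strip the supercritical weights have infinite mass for small `δ` and `lawAt x` is the junk zero measure)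
- status: established (proved in the tree: `SupercriticalSAWSpaceFillingMesoscopic_holds`, axioms `propext`, `Classical.choice`, `Quot.sound`); audit gen 12 of `…Proofs` 2026-08-16: CONFIRMED at page level [cite: DuminilCopinKozmaYadin2014, Theorem 1] [cite: DuminilCopinKozmaYadin2014, §4 (Problems 9–10)] (pp. 2–8 of arXiv:1110.3074 re-read; axiom closures of `SupercriticalSAWSpaceFilling_holds`, `SupercriticalSAW.not_robustSAWScalingLimit`, `SupercriticalSAW.sawScalingLimitAt_iff_of_pos` re-checked; forward literature 2023–2026 via arXiv / Crossref — quantitative sub-ballisticity at `x_c` on the hexagonal lattice [cite: KrachunPanagiotis2026], high-dimensional and numerical dense-phase works — none evading; the hub's local index and two citation APIs were unavailable during the audit) and STRENGTHENED on the scale axis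

[cite: DuminilCopinKozmaYadin2014, Theorem 1] -/
def SupercriticalSAWSpaceFillingMesoscopic : Prop :=
  ∀ a b : ℂ, ‖a‖ = 1 → ‖b‖ = 1 → a ≠ b →
    ∀ x : ℝ, criticalFugacity < x →
      ∀ A B : ℝ → Site 2,
        (∀ δ : ℝ, 0 < δ → IsClosestSite unitDisk δ a (A δ) ∧ IsClosestSite unitDisk δ b (B δ)) →
          ∀ r : ℝ → ℝ, (∀ δ : ℝ, 0 < δ → 0 < r δ) →
            Tendsto (fun δ : ℝ => δ * Real.log (1 / δ) / r δ) (𝓝[>] 0) (𝓝 0) →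
              Tendsto (fun δ : ℝ => lawAt x unitDisk δ (A δ) (B δ) {γ | AvoidsSomeBall (r δ) γ})
                (𝓝[>] 0) (𝓝 0)

/-- **The audited barrier holds** (`tendsto_lawAt_avoidsSomeBall`, from Theorem 1 as proved in
the tree, `DKY2014_thm1_holds`). [cite: DuminilCopinKozmaYadin2014, Theorem 1] -/
theorem SupercriticalSAWSpaceFillingMesoscopic_holds : SupercriticalSAWSpaceFillingMesoscopic :=
  fun _ _ ha hb hab _ hx _ _ hAB _ hr0 hr => tendsto_lawAt_avoidsSomeBall ha hb hab hAB hx hr0 hr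

/-- The mesoscopic barrier contains the macroscopic one: it implies the weak space-filling of
§1 for every supercritical fugacity in the disc (constant radii).
[cite: DuminilCopinKozmaYadin2014, §1 (When x > 1/μ) and Theorem 1] -/
theorem SupercriticalSAWSpaceFillingMesoscopic.isSpaceFillingFamily
    (h : SupercriticalSAWSpaceFillingMesoscopic) {a b : ℂ} (ha : ‖a‖ = 1) (hb : ‖b‖ = 1)
    (hab : a ≠ b) {x : ℝ} (hx : criticalFugacity < x) {A B : ℝ → Site 2}
    (hAB : ∀ δ : ℝ, 0 < δ → IsClosestSite unitDisk δ a (A δ) ∧ IsClosestSite unitDisk δ b (B δ)) :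
    IsSpaceFillingFamily x unitDisk A B :=
  isSpaceFillingFamily_of_tendsto_lawAt_avoidsSomeBall fun r hr =>
    h a b ha hb hab x hx A B hAB (fun _ => r) (fun _ _ => hr)
      (by simpa only [zero_div] using tendsto_mul_log_one_div_nhdsGT.div_const r)

end Literature.Barriers.CriticalPhenomena
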